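import Literature.AnabelianGeometry.SemiGraphs.TemperedCompactInVerticialHstar
import Literature.AnabelianGeometry.SemiGraphs.TreeSystemStarCondition
import Literature.AnabelianGeometry.SemiGraphs.TemperedBranchPairProfinite
import HarnessLib

/-!
# [SemiAnbd] Theorem 3.7 (iii) from the finite-level data of a chart

Mochizuki, *Semi-graphs of anabelioids*, Publ. RIMS **42** (2006), §3, Theorem 3.7 (iii), manuscript
pp. 40–41 [cite: MochizukiSemiAnbd2006, Thm 3.7(iii) pp.40-41], with the author's *Comments* (May 2020),
item (6).  Final assembly of the cell's rung 3 (ruling θ2 / r59): for a chart `c : TemperedPiChart 𝒢`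
with finite-level data `D : FiniteLevelData 𝒢 c` (`TemperedLevelData.lean`),

* `FiniteLevelData.hstar` — the condition (∗_j) of Comments (6)(b) for every nontrivial subgroup `C`,
  from total estrangement: abc-iut-L3-t11's `SemiGraph.hstar_of_noFixedBranchPairSystem` (tree
  combinatorics of Comments (6)(b)) fed by abc-iut-L3-t11's
  `noFixedBranchPairSystem_of_isTotallyEstranged'` (Remark 2.2.1 at branch level in a compact
  overgroup = the field (I4′) `stabBranchPair'`, cell ruling ν2, + `Thm37Hypotheses.isTotallyEstranged`);
* `FiniteLevelData.compactInVerticial` — both conjuncts of `CompactInVerticial` for `c`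
  (`VerticialLevelData.compactInVerticial_of_hstar`);
* `FiniteLevelData.compactInVerticial_of` — **`CompactInVerticial` (Thm. 3.7 (iii) as typed) reduced to
  Thm. 3.7 (ii) (`VerticialDistinct`), Thm. 3.7 (i) (`VerticialInjective`) and the existence of
  finite-level data for every chart** (rung 1, seat abc-iut-L3-t9); the form with data for ONE chart
  per `𝒢` is `compactInVerticial_of_one` (`TemperedCompactInVerticialOfOneChart.lean`, via the chart
  transport of `TemperedChartTransport.lean`).
Proof-only; nothing here takes a side on [IUTchIII] Cor. 3.12.
-/

namespace Literature.AnabelianGeometry.SemiGraphs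

namespace ProfiniteSemiGraph

namespace FiniteLevelData

open CategoryTheory Topology

universe v u

variable {𝒢 : ProfiniteSemiGraph.{u}} {c : TemperedPiChart 𝒢}

/-- **The condition (∗_j) of Comments (6)(b)** for a nontrivial subgroup `C` of `π₁^temp(𝒢)` acting
through the finite-level data of a chart of a `𝒢` satisfying the hypotheses of Thm. 3.7: for every
level `j` there is `i ≥ j` such that all `C`-fixed edges of `𝒢_{∞,i}` have one image in `𝒢_{∞,j}`
(total estrangement ⇒ no fixed compatible branch-pair system ⇒ (∗_j)).
[cite: MochizukiSemiAnbd2006, Thm 3.7(iii) p.41] -/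
theorem hstar (D : FiniteLevelData.{v} 𝒢 c) (h𝒢 : 𝒢.Thm37Hypotheses) (C : Subgroup c.G) (hC : C ≠ ⊥)
    (j : D.J) :
    ∃ (i : D.J) (h : j ≤ i), ∀ e e' : (D.tree i).Edge, (∀ γ : C, (D.act i γ).hom.edgeMap e = e) →
      (∀ γ : C, (D.act i γ).hom.edgeMap e' = e') → (D.trans h).edgeMap e = (D.trans h).edgeMap e' :=
  SemiGraph.hstar_of_noFixedBranchPairSystem C D.tree D.isTree D.act D.trans D.level D.levelAct D.quot
    D.quot_isImmersion D.act_quot D.levelTrans D.levelTrans_id D.levelTrans_comp D.levelTrans_act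
    D.trans_quot
    (noFixedBranchPairSystem_of_isTotallyEstranged' h𝒢 c D.level D.levelAct D.levelTrans D.stabBranchPair'
      C)
    hC j

/-- **Theorem 3.7 (iii) for the chart `c` from its finite-level data**: both conjuncts of
`CompactInVerticial` at `𝒢`, `c`, `C`, modulo Thm. 3.7 (ii) (`VerticialDistinct`) and the existence
of verticial subgroups at every vertex (Thm. 3.7 (i)). [cite: MochizukiSemiAnbd2006, Thm 3.7(iii) pp.40-41] -/
theorem compactInVerticial (D : FiniteLevelData.{v} 𝒢 c) (hVD : VerticialDistinct.{u})
    (h𝒢 : 𝒢.Thm37Hypotheses)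
    (hex : ∀ v : 𝒢.graph.Vertex, (verticialSubgroups c v).Nonempty)
    (C : Subgroup c.G) (hC : IsCompact (C : Set c.G)) :
    (∃ (v : 𝒢.graph.Vertex) (H : Subgroup c.G), H ∈ verticialSubgroups c v ∧ C ≤ H) ∧
      (C ≠ ⊥ → ∀ (v₁ v₂ : 𝒢.graph.Vertex) (H₁ H₂ : Subgroup c.G), H₁ ∈ verticialSubgroups c v₁ →
        H₂ ∈ verticialSubgroups c v₂ → H₁ ≠ H₂ → C ≤ H₁ → C ≤ H₂ →
          (∀ (v₃ : 𝒢.graph.Vertex) (H₃ : Subgroup c.G), H₃ ∈ verticialSubgroups c v₃ → C ≤ H₃ →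
              H₃ = H₁ ∨ H₃ = H₂) ∧
          ∃ (e : 𝒢.graph.Edge) (L : Subgroup c.G), 𝒢.graph.IsClosedEdge e ∧
            L ∈ edgeLikeSubgroups c e ∧ C ≤ L) :=
  VerticialLevelData.compactInVerticial_of_hstar D.toVerticialLevelData hVD h𝒢 hex
    (fun C' _ hC' j => FiniteLevelData.hstar D h𝒢 C' hC' j) C hC

/-- **`CompactInVerticial` (Theorem 3.7 (iii) as typed) REDUCED to Theorem 3.7 (ii)
(`VerticialDistinct`), Theorem 3.7 (i) (`VerticialInjective`) and the existence of finite-level data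
for every chart of every `𝒢` satisfying the hypotheses of Theorem 3.7** (the producer contract of
rung 1). [cite: MochizukiSemiAnbd2006, Thm 3.7(iii) pp.40-41] -/
theorem compactInVerticial_of (hVD : VerticialDistinct.{u}) (hVI : VerticialInjective.{u})
    (hD : ∀ (𝒢 : ProfiniteSemiGraph.{u}), 𝒢.Thm37Hypotheses → ∀ (c : TemperedPiChart 𝒢),
      Nonempty (FiniteLevelData.{v} 𝒢 c)) :
    CompactInVerticial.{u} := by
  intro 𝒢 h𝒢 c C hC
  obtain ⟨D⟩ := hD 𝒢 h𝒢 c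
  exact FiniteLevelData.compactInVerticial D hVD h𝒢 (fun v => (hVI 𝒢 h𝒢 c v).1) C hC

end FiniteLevelData

end ProfiniteSemiGraph

end Literature.AnabelianGeometry.SemiGraphs
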